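import Summits.BirchSwinnertonDyer.Rank1Residual.Partition.MainConjectures
import Literature.NumberTheory.EllipticCurves.CastellaGrossiSkinner2025.MazurMainConjecture
import Literature.NumberTheory.EllipticCurves.CastellaGrossiLeeSkinner2022.RankOneTwistIdentity
import HarnessLib

/-!
# The good-Eisenstein column (rows C6, C7 and class X1) at MAIN-CONJECTURE level

HONEST FRAMING (cell `b2b-bsdres`, run/shared/lean/b2b/bsd-rank1-residual/; verbatim): the goal is to
DELETE the COMBINATION-SHAPED residual classes for ALL analytic-rank `≤ 1` curves over `ℚ` — "full BSD
formula for every rank `≤ 1` curve in class `C`" assembled STRICTLY from published theorems — so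
that the rank-`≤ 1` remainder becomes exactly the CONSTRUCTION-SHAPED classes, which are TYPED
(missing-input `Prop`s), NOT attempted; this is not "finishing BSD". Theorems only; NO named fact and
NO definition; every published theorem enters as one of the tree's existing named Literature facts
BY NAME; nothing about any particular curve is asserted; no label changes. Unit
`b2b-bsdres-lit-cgls` (off-peak literature typer, CGLS 2022 / CGS 2025 / GV 2000), session 2 —
addendum to lit-glue's `Partition/MainConjectures.lean`, written after the typed cyclotomic main
conjecture of Castella–Grossi–Skinner 2025 landed
(`CastellaGrossiSkinner2025.thmA_charIdeal_eq_padicLFunction`, p238628; lit-glue's file, §3 row C6: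
"the tree types only Thm. D … so the main-conjecture input enters as `MazurMainConjecture W p`").

## What this file records (the reducible column of the grid at a GOOD prime `p > 2`)

At a good Eisenstein prime `p > 2` (`Good W p ∧ Red W p`; ordinary automatically,
`goodOrd_of_red_of_good`) the typed input `MazurMainConjecture W p` of the rank-`0` skeleton
(`bsdp_of_mazurMainConjecture_of_analyticRank_eq_zero`) is a THEOREM of the published record on two
overlapping loci and OPEN on exactly their common complement:

| locus at `(E, p)`, `p > 2` good, `E[p]` reducible | `MazurMainConjecture W p` | tree fact |
|---|---|---|
| `a_p ≢ 1 (mod p)` (`¬ Anom`) — row **C6** | THEOREM: Castella–Grossi–Skinner 2025 Thm. A | `CastellaGrossiSkinner2025.thmA_charIdeal_eq_padicLFunction` (PUB; doc. note `CGS25-BST-Thm311`) |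
| GV parity (`GVPar`) — row **C7** at `r = 0` | THEOREM: Greenberg–Vatsal 2000 Thm. 1.3 (+ Kato) | `GreenbergVatsal2000.thm13_charIdeal_eq_of_gvPar` (PUB) |
| `Anom ∧ ¬ GVPar` (class **X1**, parity type A) | OPEN — the typed input `MazurMainConjectureOnX1TypeA` | (Keller–Yin §0.5 / M. Yin §0.2 claim it in prose; no theorem in print) |

so that (`forall_mazurMainConjecture_eisenstein_iff_typeA`) **granted the two published facts,
"Mazur's main conjecture at every good Eisenstein prime `p > 2` of every `E/ℚ`" is EQUIVALENT to the
typed X1 residue `MazurMainConjectureOnX1TypeA`** — the reducible column of the main-conjecture grid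
is partitioned with no cell unaccounted for, and the published cyclotomic theorem of CGS 2025 upgrades
NO input of class X1 (anomaly `a_p ≡ 1 (mod p)` is exactly the excluded hypothesis `φ|_{G_p} ∈ {1, ω}`
of Thm. A; it is moreover invariant under the admissible partner twist `E ↦ E^K`, `p` split in `K`,
and under `E[p]`-congruence, so neither the rank-one partner input `PartnerPPartRankZeroOnX1` nor
the congruence-transfer routes of X1 meet the locus of Thm. A — recorded Literature-side as
`CastellaGrossiLeeSkinner2022.partner_good_red_not_anom`).

Row theorems, one level deeper than `Partition/Bsdp.lean` (which takes CGS Thm. D / the GV chain as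
the named facts): `RowC6.mazurMainConjecture_of_cgsThmA`, `RowC6.bsdp_rankZero_of_cgsThmA`
(C6 ∩ {r = 0} from the PUBLISHED main conjecture + Greenberg's Thm. 4.1 — no `@[conjecture]` input
left), `RowC7.mazurMainConjecture_of_gvThm13`, `RowC7.bsdp_of_mainConjectures` (C7 through the same
universal skeleton as rows C1/C2/C6/C16). The rank-ONE half of row C6 along its PRINTED route
(CGLS 2022 (5.7) + Thm. A for the partner, no Schneider certificate) is the Literature theorem
`CastellaGrossiLeeSkinner2022.bsdp_rankOne_of_display57_of_thmA` (p239544, in the tree); its row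
wrappers `RowC6.bsdp_rankOne_of_display57_of_cgsThmA`, `RowC6.bsdp_of_display57_of_cgsThmA`
(`r ≤ 1`, every input a named tree fact, none `_OPEN`, no certificate) close §4 below.

References: Castella–Grossi–Skinner 2025 Thm. A (= Thm. 6.0.5), Thm. D and proof §0.3
[CastellaGrossiSkinner2025]; Greenberg–Vatsal 2000 Thm. (1.3) [GreenbergVatsal2000]; Greenberg LNM
1716 Thm. 4.1 [GreenbergLNM1716]; Castella–Grossi–Lee–Skinner 2022 Thm. 5.1.4 and proof of Thm.
5.3.1 [CastellaEtAl2021]; Keller–Yin arXiv:2402.12781v2 §0.5 [KellerYin2024]; RESIDUAL-CASES.md §a.1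
C6/C7, §a.2 X1; HOME/b2b-bsdres-lit-cgls/CGLS-GV-TYPING.md §9.
-/

set_option autoImplicit false

noncomputable section

open scoped Classical MatrixGroups ModularForm

open CongruenceSubgroup WeierstrassCurve Literature.NumberTheory.EllipticCurves
  Literature.NumberTheory.EllipticCurves.ModularForms
  Literature.NumberTheory.EllipticCurves.Rank1Residual
  Summit.BirchSwinnertonDyer.BirchSwinnertonDyer.Theorems.Rank1ResidualX1Defs

namespace Summit.BirchSwinnertonDyer.Rank1Residual

section Curve

variable {W : WeierstrassCurve ℚ} [W.IsElliptic] [W.IsGloballyMinimal] {p : ℕ} [Fact p.Prime]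

/-! ### §1. Castella–Grossi–Skinner's theorem is an instance of the typed input -/

/-- **CGS 2025 Theorem A is an instance of the typed input**: at a good Eisenstein prime `p > 2` with
`a_p ≢ 1 (mod p)` (`φ|_{G_p} ≠ 1, ω`), `MazurMainConjecture W p` holds — the named fact
`CastellaGrossiSkinner2025.thmA_charIdeal_eq_padicLFunction` has, after its four hypotheses on
`(E, p)`, exactly the body of `MazurMainConjecture W p` (Néron normalisation, `ϖ · Ω_E = Ω⁺_f`).
Companion of `Rank1ResidualX1RankOne.mazurMainConjecture_of_gvPar` (Greenberg–Vatsal on the parity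
locus). [cite: CastellaGrossiSkinner2025, Theorem A (§0) = Thm. 6.0.5 (§6)] -/
theorem mazurMainConjecture_of_cgsThmA
    (hA : CastellaGrossiSkinner2025.thmA_charIdeal_eq_padicLFunction)
    (hp : 2 < p) (hgood : Good W p) (hred : Red W p) (hna : ¬ Anom W p) :
    MazurMainConjecture W p :=
  hA W p hp hgood hred hna

/-- **Row C6 ⟹ the typed input is a theorem** (CGS 2025 Thm. A). [cite: CastellaGrossiSkinner2025, Theorem A] -/
theorem RowC6.mazurMainConjecture_of_cgsThmA
    (hA : CastellaGrossiSkinner2025.thmA_charIdeal_eq_padicLFunction) (h : RowC6 W p) :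
    MazurMainConjecture W p :=
  Summit.BirchSwinnertonDyer.Rank1Residual.mazurMainConjecture_of_cgsThmA hA h.1 h.2.2.1 h.2.1 h.2.2.2

/-- **Row C7 ⟹ the typed input is a theorem** (Greenberg–Vatsal 2000 Thm. 1.3 with Kato's
divisibility, the named fact `thm13_charIdeal_eq_of_gvPar`, whose body after its hypotheses is that of
`MazurMainConjecture W p`). [cite: GreenbergVatsal2000, Thm. (1.3)] -/
theorem RowC7.mazurMainConjecture_of_gvThm13 (hGV : GreenbergVatsal2000.thm13_charIdeal_eq_of_gvPar)
    (h : RowC7 W p) : MazurMainConjecture W p :=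
  hGV W p h.2.2.1 h.2.2.2.1.1 h.2.2.2.1.2 h.2.2.2.2.2

/-! ### §2. The rows, one level deeper -/

/-- **C6 ∩ {r = 0} at main-conjecture level with NO open input**: the PUBLISHED cyclotomic main
conjecture of Castella–Grossi–Skinner 2025 (Thm. A, `hA`) + Greenberg 1999 Thm. 4.1 (`hGr`) +
modularity (`hmod`) + Gross–Zagier–Kolyvagin (`hGZK`) ⟹ `BSD(E,p)` — lit-glue's
`RowC6.bsdp_rankZero_of_mazurMainConjecture` fed by `RowC6.mazurMainConjecture_of_cgsThmA`. This is
the printed proof of CGS Thm. D (`r = 0`): "the argument is the same as in [CGLS22, Thm. 5.1.4],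
replacing the appeal to [GV00] by an appeal to our Theorem A"; Literature twin:
`CastellaGrossiSkinner2025.pPartRankZero_of_thmA`. Compare `RowC6.bsdp` (Partition/Bsdp), which takes
Thm. D itself (A47) as the named fact. [cite: CastellaGrossiSkinner2025, Thm. D (= "Thm. 4") and its proof (§0.3 p. 5), Theorem A]
[cite: GreenbergLNM1716, Thm. 4.1 (p. 102)] [cite: CastellaEtAl2021, Thm. 5.1.4] -/
theorem RowC6.bsdp_rankZero_of_cgsThmA
    (hA : CastellaGrossiSkinner2025.thmA_charIdeal_eq_padicLFunction)
    (hGr : greenberg_charValue_rankZero) (hmod : nonempty_modularParametrizationData)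
    (hGZK : rank_eq_analyticRank_of_analyticRank_le_one) (h : RowC6 W p) (hr0 : W.analyticRank = 0) :
    BSDp W p :=
  RowC6.bsdp_rankZero_of_mazurMainConjecture hGr hmod hGZK h hr0
    (RowC6.mazurMainConjecture_of_cgsThmA hA h)

/-- **C7 at main-conjecture level** (rank `0`, odd good ordinary Eisenstein `p` with the GV parity
condition): Greenberg–Vatsal 2000 Thm. 1.3 (`hGV`, the main conjecture) + Greenberg 1999 Thm. 4.1
(`hGr`) + modularity + GZK ⟹ `BSD(E,p)`, through the same universal rank-`0` skeleton
`bsdp_of_mazurMainConjecture_of_analyticRank_eq_zero` as rows C1/C2/C6/C16 (Castella–Grossi–Lee–Skinner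
2022 Thm. 5.1.4 is exactly this deduction). Same inputs as `RowC7.bsdp` (Partition/Bsdp, via the
Literature chain `GreenbergVatsal2000.pPartRankZero_of_gvPar`); recorded for the uniform MC-level
reading of the table. [cite: GreenbergVatsal2000, Thm. (1.3)] [cite: CastellaEtAl2021, Thm. 5.1.4]
[cite: GreenbergLNM1716, Thm. 4.1 (p. 102)] -/
theorem RowC7.bsdp_of_mainConjectures (hGV : GreenbergVatsal2000.thm13_charIdeal_eq_of_gvPar)
    (hGr : greenberg_charValue_rankZero) (hmod : nonempty_modularParametrizationData)
    (hGZK : rank_eq_analyticRank_of_analyticRank_le_one) (h : RowC7 W p) : BSDp W p :=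
  bsdp_of_mazurMainConjecture_of_analyticRank_eq_zero hGr hmod hGZK h.2.2.1 h.2.2.2.1 h.1
    (RowC7.mazurMainConjecture_of_gvThm13 hGV h)

/-- **Off the type-A corner the typed input is a theorem**: at a good Eisenstein prime `p > 2`,
`¬ Anom W p ∨ GVPar W p` ⟹ `MazurMainConjecture W p` (CGS Thm. A on the first disjunct,
Greenberg–Vatsal Thm. 1.3 on the second; ordinarity from `goodOrd_of_red_of_good`). "Our results
include giving a new proof for the case previously handled by Greenberg–Vatsal" (CGS p. 3) on the
overlap. [cite: CastellaGrossiSkinner2025, Theorem A and §0 p. 3] [cite: GreenbergVatsal2000, Thm. (1.3)] -/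
theorem mazurMainConjecture_of_not_anom_or_gvPar
    (hA : CastellaGrossiSkinner2025.thmA_charIdeal_eq_padicLFunction)
    (hGV : GreenbergVatsal2000.thm13_charIdeal_eq_of_gvPar)
    (hp : 2 < p) (hgood : Good W p) (hred : Red W p) (h : ¬ Anom W p ∨ GVPar W p) :
    MazurMainConjecture W p := by
  rcases h with hna | hpar
  · exact mazurMainConjecture_of_cgsThmA hA hp hgood hred hna
  · have hord : GoodOrd W p := goodOrd_of_red_of_good W p hp hgood hred
    exact hGV W p (by omega) hord.1 hord.2 hpar

end Curve

/-! ### §3. The reducible column of the main-conjecture grid is partitioned: the residue is EXACTLY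
the X1 type-A corner -/

/-- **Granted the two PUBLISHED cyclotomic main conjectures at Eisenstein primes (CGS 2025 Thm. A,
Greenberg–Vatsal 2000 Thm. 1.3), "Mazur's main conjecture at every good Eisenstein prime `p > 2` of
every elliptic curve over `ℚ`" holds IF AND ONLY IF the typed X1 residue `MazurMainConjectureOnX1TypeA`
holds** (Mazur's main conjecture at the anomalous good Eisenstein primes of parity type A — not in
print; Keller–Yin §0.5 / M. Yin §0.2 claim it in prose). ⇒: restrict. ⇐: a good Eisenstein `p > 2`
is either non-anomalous (Thm. A), or anomalous of type B (`GVPar`: Greenberg–Vatsal), or anomalous of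
type A — and then `ClassX1 W p` holds (its clause `¬(r = 0 ∧ gvpar)` being implied by `¬ gvpar`), so
the residue applies. No cell of the reducible good-`p` column maps to neither a published theorem nor
the typed residue; CGS Thm. A upgrades no X1 input. [cite: CastellaGrossiSkinner2025, Theorem A]
[cite: GreenbergVatsal2000, Thm. (1.3)] [cite: KellerYin2024, §0.5 (prose claim)] -/
theorem forall_mazurMainConjecture_eisenstein_iff_typeA
    (hA : CastellaGrossiSkinner2025.thmA_charIdeal_eq_padicLFunction)
    (hGV : GreenbergVatsal2000.thm13_charIdeal_eq_of_gvPar) :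
    (∀ (W : WeierstrassCurve ℚ) [W.IsElliptic] [W.IsGloballyMinimal] (p : ℕ) [Fact p.Prime],
        2 < p → Good W p → Red W p → MazurMainConjecture W p) ↔
      MazurMainConjectureOnX1TypeA := by
  constructor
  · intro h W _ _ p _ hX1 _
    exact h W p hX1.1 hX1.2.2.1 hX1.2.1
  · intro hT W _ _ p _ hp hgood hred
    by_cases hna : Anom W p
    · by_cases hpar : GVPar W p
      · exact mazurMainConjecture_of_not_anom_or_gvPar hA hGV hp hgood hred (Or.inr hpar)
      · exact hT W p ⟨hp, hred, hgood, hna, fun h0 ↦ hpar h0.2⟩ hpar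
    · exact mazurMainConjecture_of_not_anom_or_gvPar hA hGV hp hgood hred (Or.inl hna)

/-- **Hence, at rank `0`, the whole reducible good-`p > 2` column at main-conjecture level**: granted
CGS Thm. A, GV Thm. 1.3 and the typed residue `MazurMainConjectureOnX1TypeA`, together with Greenberg
Thm. 4.1, modularity and GZK, `BSD(E,p)` holds for EVERY `E/ℚ` with `ord_{s=1} L(E,s) = 0` at EVERY
good Eisenstein prime `p > 2` — rows C6 ∩ {r = 0}, C7 and class X1 ∩ {r = 0} through one skeleton.
(The rank-`1` column needs, besides, the rank-one display: CGLS 2022 (5.7) off the anomalous line —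
Literature `CastellaGrossiLeeSkinner2022.bsdp_rankOne_of_display57_of_thmA` —, Keller–Yin's OPEN
display on it.) [cite: CastellaGrossiSkinner2025, Theorem A, Thm. D] [cite: GreenbergVatsal2000, Thm. (1.3)]
[cite: CastellaEtAl2021, Thm. 5.1.4] [cite: GreenbergLNM1716, Thm. 4.1 (p. 102)] -/
theorem bsdp_rankZero_eisenstein_of_mainConjectures
    (hA : CastellaGrossiSkinner2025.thmA_charIdeal_eq_padicLFunction)
    (hGV : GreenbergVatsal2000.thm13_charIdeal_eq_of_gvPar) (hT : MazurMainConjectureOnX1TypeA)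
    (hGr : greenberg_charValue_rankZero) (hmod : nonempty_modularParametrizationData)
    (hGZK : rank_eq_analyticRank_of_analyticRank_le_one)
    (W : WeierstrassCurve ℚ) [W.IsElliptic] [W.IsGloballyMinimal] (p : ℕ) [Fact p.Prime]
    (hp : 2 < p) (hgood : Good W p) (hred : Red W p) (hr0 : W.analyticRank = 0) : BSDp W p :=
  bsdp_of_mazurMainConjecture_of_analyticRank_eq_zero hGr hmod hGZK (by omega)
    (goodOrd_of_red_of_good W p hp hgood hred) hr0
    ((forall_mazurMainConjecture_eisenstein_iff_typeA hA hGV).mpr hT W p hp hgood hred)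

/-! ### §4. Row C6 at rank one along its PRINTED route ((5.7) + Theorem A for the partner) -/

section RankOne

variable {W : WeierstrassCurve ℚ} [W.IsElliptic] [W.IsGloballyMinimal] {p : ℕ} [Fact p.Prime]

/-- **C6 ∩ {r = 1} along its PRINTED route, no certificate**: Castella–Grossi–Lee–Skinner 2022
display (5.7) (`h57`, the typed `CastellaGrossiLeeSkinner2022.display57_rankOne_twist`: the
anticyclotomic package — BDP main conjecture Thm. 4.2.2 + control Thm. 5.1.1 + BDP formula +
Gross–Zagier + Kolyvagin — collapsed to its printed consequence) + Castella–Grossi–Skinner 2025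
Thm. A for the partner `E^K` (`hA`) + Greenberg Thm. 4.1 (`hGr`) + modularity (`hmodP`, `hmod`) +
Hoffstein–Luo (`hHL`) + Gross–Zagier I.7.3 (`hGZ`) + GZK ⟹ `BSD(E,p)`: the Literature theorem
`CastellaGrossiLeeSkinner2022.bsdp_rankOne_of_display57_of_thmA` read on row C6. Replaces, for this
row, the cyclotomic skeleton modulo Schneider (`RowC6.bsdp_rankOne_of_mazurMainConjecture_of_schneider`,
"NOT the printed route"). [cite: CastellaGrossiSkinner2025, Thm. D (= "Thm. 4") and its proof (§0.3 p. 5)]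
[cite: CastellaEtAl2021, proof of Thm. 5.3.1, display (5.7)] [cite: GreenbergLNM1716, Thm. 4.1 (p. 102)] -/
theorem RowC6.bsdp_rankOne_of_display57_of_cgsThmA
    (h57 : CastellaGrossiLeeSkinner2022.display57_rankOne_twist)
    (hA : CastellaGrossiSkinner2025.thmA_charIdeal_eq_padicLFunction)
    (hGr : greenberg_charValue_rankZero) (hmodP : nonempty_modularParametrizationData)
    (hmod : exists_isNewformOf) (hHL : HoffsteinLuo1997_exists_twist_L_one_ne_zero)
    (hGZ : GrossZagier1986_thm_I_7_3) (hGZK : rank_eq_analyticRank_of_analyticRank_le_one)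
    (h : RowC6 W p) (hr1 : W.analyticRank = 1) : BSDp W p :=
  CastellaGrossiLeeSkinner2022.bsdp_rankOne_of_display57_of_thmA h57 hA hGr hmodP hmod hHL hGZ hGZK
    W p h.1 h.2.2.1 h.2.1 h.2.2.2 hr1

/-- **Row C6 (`r ≤ 1`) entirely at "typed main conjecture + typed display" level**: CGS 2025 Thm. D
re-assembled from Theorem A (`r = 0` directly; `r = 1` through the partner) and CGLS 2022 (5.7),
with Greenberg Thm. 4.1, modularity, Hoffstein–Luo, Gross–Zagier, GZK — every input a named tree fact,
none `_OPEN`, no Schneider certificate. Compare `RowC6.bsdp` (Partition/Bsdp: Thm. D itself, A47).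
[cite: CastellaGrossiSkinner2025, Thm. D (= "Thm. 4") and its proof (§0.3 p. 5), Theorem A]
[cite: CastellaEtAl2021, Thm. 5.1.4 and proof of Thm. 5.3.1] -/
theorem RowC6.bsdp_of_display57_of_cgsThmA
    (h57 : CastellaGrossiLeeSkinner2022.display57_rankOne_twist)
    (hA : CastellaGrossiSkinner2025.thmA_charIdeal_eq_padicLFunction)
    (hGr : greenberg_charValue_rankZero) (hmodP : nonempty_modularParametrizationData)
    (hmod : exists_isNewformOf) (hHL : HoffsteinLuo1997_exists_twist_L_one_ne_zero)
    (hGZ : GrossZagier1986_thm_I_7_3) (hGZK : rank_eq_analyticRank_of_analyticRank_le_one)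
    (h : RowC6 W p) (hr : W.analyticRank ≤ 1) : BSDp W p :=
  CastellaGrossiLeeSkinner2022.bsdp_of_display57_of_thmA h57 hA hGr hmodP hmod hHL hGZ hGZK
    W p h.1 h.2.2.1 h.2.1 h.2.2.2 hr

end RankOne

end Summit.BirchSwinnertonDyer.Rank1Residual

end
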